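import Summits.ResolutionOfSingularities.ResolutionOfSingularities.Theorems.PurelyInseparableDim4Rules
import Summits.ResolutionOfSingularities.ResolutionOfSingularities.Theorems.PurelyInseparableDim4CoordinateTrap
import Summits.ResolutionOfSingularities.ResolutionOfSingularities.Theorems.PurelyInseparableDim4TrapBaseChange
import Literature.AlgebraicGeometry.Resolution.CentreBlowupOrdAlongBasics
import Literature.AlgebraicGeometry.Resolution.PointBlowupKangaroo
import HarnessLib

/-!
# The coordinate cage at EVERY prime: `¬ TerminatesSomeRule p p` for all primes `p`

[OURS · counted 0] **Negative result about OUR candidate frame v2** (`PIDim4.TerminatesSomeRule`: «some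
Hironaka-permissible COORDINATE-centre rule has no infinite branch», desk WORD #17 (iii), cell
`res-dim4-pi`) — nothing about resolution of singularities.  TY-7 (`…CoordinateTrap`, res-dim4-idea-3
TRAP-1) is `p = 2`; this is res-dim4-idea-3's uniform family P-3-2 «coordinate cage», `p` symbolic:
`F_ε = x₃^{p-1}x₄ + ε x₂x₃^{p-1} + x₂x₃^{p-1}x₄ + x₁^p x₂ ∈ 𝔽_p[x₁..x₄]` (`ε = ±1`), `s_ε = (F_ε, 0, {x₂})`;
`ord F_ε = p`; the point is the ONLY Hironaka-permissible coordinate centre (`x₁^p x₂` forces `x₁ ∈ S`,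
`x₃^{p-1}x₄`, `x₂x₃^{p-1}` force `x₂,x₃,x₄ ∈ S`); in the `x₂`-chart at `b_ε = (0,0,0,−ε)` the cleaned
transform is `F_{−ε}`, `r = 0`, `exc = {x₂}`: `step p univ x₂ b_ε s_ε = s_{−ε}`.  So `{s₁, s₋₁}` is an
`IsTrap` over `𝔽_p` (at `p = 2` both states are `Trap1.s0`: `s_two_one`), `TerminatesSomeRule p p` fails
for every prime (`not_terminatesSomeRule_of_prime`) and, by res-dim4-p-14's base change, over EVERY
field of characteristic `p` every permissible coordinate rule has an infinite branch
(`not_terminatesUnder_of_prime`).  Geometry: `F_ε = x₃^{p-1}(x₄ + εx₂ + x₂x₄) + x₁^p x₂`; the `p`-fold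
locus contains the smooth NON-coordinate curve `{x₁ = x₃ = 0, x₄ = −εx₂/(1+x₂)}`, self-similar under
the point blow-up — blindness of coordinate centres, present already in three base variables (WORD #20
(b)).  `x₁..x₄` = `Fin 4`.  Found by res-dim4-idea-3 (hand proof; script `p ≤ 7`); kernel-checked for all
`p` by res-dim4-typ-1 (brick CAGE-∀p, desk GO WORD #26 (i)). Supports stmt-ResolutionOfSingularities-16155.
-/

set_option linter.dupNamespace false -- mandated namespace of this single-conjunct summit

noncomputable section
namespace Summit.ResolutionOfSingularities.ResolutionOfSingularities.Theorems.PIDim4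

namespace Cage

open MvPolynomial Finset
open Literature.AlgebraicGeometry.Resolution
open Literature.AlgebraicGeometry.Resolution.Hauser2010
open Literature.AlgebraicGeometry.Resolution.CentreBlowup

variable (p : ℕ)

/-- exponent of `x₃^{p-1} x₄`. [folklore] -/
def eA : Fin 4 →₀ ℕ := Finsupp.equivFunOnFinite.symm ![0, 0, p - 1, 1]
/-- exponent of `x₂ x₃^{p-1}`. [folklore] -/
def eB : Fin 4 →₀ ℕ := Finsupp.equivFunOnFinite.symm ![0, 1, p - 1, 0]
/-- exponent of `x₂ x₃^{p-1} x₄`. [folklore] -/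
def eC : Fin 4 →₀ ℕ := Finsupp.equivFunOnFinite.symm ![0, 1, p - 1, 1]
/-- exponent of `x₁^p x₂`. [folklore] -/
def eD : Fin 4 →₀ ℕ := Finsupp.equivFunOnFinite.symm ![p, 1, 0, 0]
/-- exponent of `x₃^{p-1}` (the `x₂`-chart image of `eB`). [folklore] -/
def eB' : Fin 4 →₀ ℕ := Finsupp.equivFunOnFinite.symm ![0, 0, p - 1, 0]

/-- Pointwise values of `eA`. -/ @[simp] theorem eA_apply (i : Fin 4) : eA p i = ![0, 0, p - 1, 1] i := rfl
/-- Pointwise values of `eB`. -/ @[simp] theorem eB_apply (i : Fin 4) : eB p i = ![0, 1, p - 1, 0] i := rfl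
/-- Pointwise values of `eC`. -/ @[simp] theorem eC_apply (i : Fin 4) : eC p i = ![0, 1, p - 1, 1] i := rfl
/-- Pointwise values of `eD`. -/ @[simp] theorem eD_apply (i : Fin 4) : eD p i = ![p, 1, 0, 0] i := rfl
/-- Pointwise values of `eB'`. -/ @[simp] theorem eB'_apply (i : Fin 4) : eB' p i = ![0, 0, p - 1, 0] i := rfl

/-- Exponents differing at one index are different. -/
private theorem ne_of_apply_ne' {d e : Fin 4 →₀ ℕ} (i : Fin 4) (h : d i ≠ e i) : d ≠ e := (h <| · ▸ rfl)

/-- `eA ≠ eB`. -/ theorem eA_ne_eB : eA p ≠ eB p := ne_of_apply_ne' 1 (by simp)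
/-- `eA ≠ eC`. -/ theorem eA_ne_eC : eA p ≠ eC p := ne_of_apply_ne' 1 (by simp)
/-- `eA ≠ eD`. -/ theorem eA_ne_eD : eA p ≠ eD p := ne_of_apply_ne' 1 (by simp)
/-- `eB ≠ eC`. -/ theorem eB_ne_eC : eB p ≠ eC p := ne_of_apply_ne' 3 (by simp)
/-- `eC ≠ eD`. -/ theorem eC_ne_eD : eC p ≠ eD p := ne_of_apply_ne' 3 (by simp)
/-- `eA ≠ eB'`. -/ theorem eA_ne_eB' : eA p ≠ eB' p := ne_of_apply_ne' 3 (by simp)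
/-- `eB' ≠ eC`. -/ theorem eB'_ne_eC : eB' p ≠ eC p := ne_of_apply_ne' 1 (by simp)
/-- `eB' ≠ eD`. -/ theorem eB'_ne_eD : eB' p ≠ eD p := ne_of_apply_ne' 1 (by simp)

/-- `eA` as a sum of singles. -/ theorem single_eA : Finsupp.single (2 : Fin 4) (p - 1) + Finsupp.single 3 1 = eA p := by
  ext i; fin_cases i <;> simp
/-- `eB` as a sum of singles. -/ theorem single_eB : Finsupp.single (1 : Fin 4) 1 + Finsupp.single 2 (p - 1) = eB p := by
  ext i; fin_cases i <;> simp
/-- `eC` as a sum of singles. -/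
theorem single_eC :
    Finsupp.single (1 : Fin 4) 1 + Finsupp.single 2 (p - 1) + Finsupp.single 3 1 = eC p := by
  ext i; fin_cases i <;> simp
/-- `eD` as a sum of singles. -/ theorem single_eD : Finsupp.single (0 : Fin 4) p + Finsupp.single 1 1 = eD p := by
  ext i; fin_cases i <;> simp
/-- `eB'` as a single. -/ theorem single_eB' : Finsupp.single (2 : Fin 4) (p - 1) = eB' p := by
  ext i; fin_cases i <;> simp

variable {p} [hp : Fact p.Prime]

/-- `eB ≠ eD` (uses `p ≠ 0`). -/
theorem eB_ne_eD : eB p ≠ eD p := ne_of_apply_ne' 0 (by simp; exact hp.out.ne_zero.symm)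

/-- The field `𝔽_p`. [folklore] -/
abbrev Kp (p : ℕ) : Type := ZMod p

variable (p) in
/-- `F_ε = x₃^{p-1}x₄ + ε x₂x₃^{p-1} + x₂x₃^{p-1}x₄ + x₁^p x₂` over `𝔽_p`. [folklore] -/
def F (ε : Kp p) : MvPolynomial (Fin 4) (Kp p) :=
  monomial (eA p) 1 + monomial (eB p) ε + monomial (eC p) 1 + monomial (eD p) 1

variable (p) in
/-- `G_ε = x₃^{p-1}x₄ + ε x₃^{p-1} + x₂x₃^{p-1}x₄ + x₁^p x₂` = the `x₂`-chart transform of `F_ε`. [folklore] -/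
def G (ε : Kp p) : MvPolynomial (Fin 4) (Kp p) :=
  monomial (eA p) 1 + monomial (eB' p) ε + monomial (eC p) 1 + monomial (eD p) 1

variable (p) in
/-- `s_ε = (F_ε, r = 0, exc = {x₂})`. [folklore] -/
def s (ε : Kp p) : State (Kp p) := ⟨F p ε, 0, {1}⟩

variable (p) in
/-- the chart point `b_ε = (0,0,0,−ε)` (`x₄ ↦ x₄ − ε`). [folklore] -/
def b (ε : Kp p) : Fin 4 → Kp p := ![0, 0, 0, -ε]

/-- `b_ε 0 = 0`. -/ @[simp] theorem b_zero (ε : Kp p) : b p ε 0 = 0 := rfl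
/-- `b_ε 1 = 0`. -/ @[simp] theorem b_one (ε : Kp p) : b p ε 1 = 0 := rfl
/-- `b_ε 2 = 0`. -/ @[simp] theorem b_two (ε : Kp p) : b p ε 2 = 0 := rfl
/-- `b_ε 3 = -ε`. -/ @[simp] theorem b_three (ε : Kp p) : b p ε 3 = -ε := rfl

/-! ## coefficients, support, order -/

/-- Coefficients of `F_ε`. -/
theorem coeff_F (ε : Kp p) (d : Fin 4 →₀ ℕ) :
    coeff d (F p ε) = (if eA p = d then 1 else 0) + (if eB p = d then ε else 0)
      + (if eC p = d then 1 else 0) + (if eD p = d then 1 else 0) := by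
  simp only [F, coeff_add, coeff_monomial]

/-- The coefficient of `x₃^{p-1}x₄` in `F_ε` is `1`. -/
theorem coeff_eA_F (ε : Kp p) : coeff (eA p) (F p ε) = 1 := by
  rw [coeff_F, if_pos rfl, if_neg (eA_ne_eB p).symm, if_neg (eA_ne_eC p).symm,
    if_neg (eA_ne_eD p).symm]; simp

/-- The coefficient of `x₂x₃^{p-1}` in `F_ε` is `ε`. -/
theorem coeff_eB_F (ε : Kp p) : coeff (eB p) (F p ε) = ε := by
  rw [coeff_F, if_neg (eA_ne_eB p), if_pos rfl, if_neg (eB_ne_eC p).symm, if_neg eB_ne_eD.symm]; simp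

/-- The coefficient of `x₁^p x₂` in `F_ε` is `1`. -/
theorem coeff_eD_F (ε : Kp p) : coeff (eD p) (F p ε) = 1 := by
  rw [coeff_F, if_neg (eA_ne_eD p), if_neg eB_ne_eD, if_neg (eC_ne_eD p), if_pos rfl]; simp

/-- `F_ε ≠ 0`. -/
theorem F_ne_zero (ε : Kp p) : F p ε ≠ 0 := fun h => by simpa [h] using coeff_eA_F ε

/-- The support of `F_ε` is contained in its four exponents. -/
theorem support_F_subset (ε : Kp p) : (F p ε).support ⊆ {eA p, eB p, eC p, eD p} := by
  intro d hd
  rw [MvPolynomial.mem_support_iff, coeff_F] at hd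
  simp only [Finset.mem_insert, Finset.mem_singleton]
  by_cases h1 : d = eA p
  · exact Or.inl h1
  by_cases h2 : d = eB p
  · exact Or.inr (Or.inl h2)
  by_cases h3 : d = eC p
  · exact Or.inr (Or.inr (Or.inl h3))
  by_cases h4 : d = eD p
  · exact Or.inr (Or.inr (Or.inr h4))
  exfalso
  rw [if_neg (Ne.symm h1), if_neg (Ne.symm h2), if_neg (Ne.symm h3), if_neg (Ne.symm h4)] at hd
  simp at hd

/-- Total degrees of the four exponents: `|eA| = |eB| = p`, `|eC| = |eD| = p + 1`. -/
theorem degIn_univ_exponents :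
    degIn Finset.univ (eA p) = p ∧ degIn Finset.univ (eB p) = p ∧
      degIn Finset.univ (eC p) = p + 1 ∧ degIn Finset.univ (eD p) = p + 1 := by
  have h1 := hp.out.one_le
  refine ⟨?_, ?_, ?_, ?_⟩ <;> (rw [Trap1.degIn_univ4]; simp <;> omega)

/-- No monomial of degree `< p` in `F_ε`. [folklore] -/
theorem coeff_F_of_degree_lt (ε : Kp p) {d : Fin 4 →₀ ℕ} (hd : d.degree < p) : coeff d (F p ε) = 0 := by
  obtain ⟨hA, hB, hC, hD⟩ := degIn_univ_exponents (p := p)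
  rw [← degIn_univ] at hd
  have h1 : eA p ≠ d := fun h => by subst h; omega
  have h2 : eB p ≠ d := fun h => by subst h; omega
  have h3 : eC p ≠ d := fun h => by subst h; omega
  have h4 : eD p ≠ d := fun h => by subst h; omega
  rw [coeff_F, if_neg h1, if_neg h2, if_neg h3, if_neg h4]; simp

/-- `ord F_ε = p` along the point. [folklore] -/
theorem ordAlong_univ_F (ε : Kp p) : ordAlong Finset.univ (F p ε) = p := by
  obtain ⟨hA, hB, hC, hD⟩ := degIn_univ_exponents (p := p)
  apply le_antisymm
  · have := ordAlong_le_of_coeff_ne_zero (S := Finset.univ) (d := eA p) (F := F p ε)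
      (by rw [coeff_eA_F]; exact one_ne_zero)
    rwa [hA] at this
  · apply le_ordAlong_of_forall
    intro d hd
    have hd' := support_F_subset ε hd
    simp only [Finset.mem_insert, Finset.mem_singleton] at hd'
    rcases hd' with rfl | rfl | rfl | rfl <;> omega

/-! ## the point is the only Hironaka-permissible coordinate centre (`ε ≠ 0`) -/

/-- Along every coordinate triple the order of `F_ε` is `< p` (`ε ≠ 0`). [folklore] -/
theorem ordAlong_erase_lt {ε : Kp p} (hε : ε ≠ 0) (i : Fin 4) :
    ordAlong (Finset.univ.erase i) (F p ε) < p := by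
  have h2 := hp.out.two_le
  have hlt : ((p - 1 : ℕ) : ℕ∞) < (p : ℕ∞) := by exact_mod_cast (show p - 1 < p by omega)
  refine lt_of_le_of_lt ?_ hlt
  fin_cases i
  · have hT : (Finset.univ : Finset (Fin 4)).erase 0 = Trap1.T0 := by decide
    have := ordAlong_le_of_coeff_ne_zero (S := Trap1.T0) (d := eD p) (F := F p ε)
      (by rw [coeff_eD_F]; exact one_ne_zero)
    rw [Trap1.degIn_T0] at this; simp at this; simpa [hT] using le_trans this (by exact_mod_cast (by omega))
  · have hT : (Finset.univ : Finset (Fin 4)).erase 1 = Trap1.T1 := by decide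
    have := ordAlong_le_of_coeff_ne_zero (S := Trap1.T1) (d := eB p) (F := F p ε)
      (by rw [coeff_eB_F]; exact hε)
    rw [Trap1.degIn_T1] at this; simp at this; simpa [hT] using this
  · have hT : (Finset.univ : Finset (Fin 4)).erase 2 = Trap1.T2 := by decide
    have := ordAlong_le_of_coeff_ne_zero (S := Trap1.T2) (d := eA p) (F := F p ε)
      (by rw [coeff_eA_F]; exact one_ne_zero)
    rw [Trap1.degIn_T2] at this; simp at this; simpa [hT] using le_trans this (by exact_mod_cast (by omega))
  · have hT : (Finset.univ : Finset (Fin 4)).erase 3 = Trap1.T3 := by decide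
    have := ordAlong_le_of_coeff_ne_zero (S := Trap1.T3) (d := eA p) (F := F p ε)
      (by rw [coeff_eA_F]; exact one_ne_zero)
    rw [Trap1.degIn_T3] at this; simp at this; simpa [hT] using this

/-- **The point `univ` is the only Hironaka-permissible coordinate centre for `F_ε`** (`ε ≠ 0`). [folklore] -/
theorem eq_univ_of_isPermissibleCentre {ε : Kp p} (hε : ε ≠ 0) {S : Finset (Fin 4)}
    (h : IsPermissibleCentre p S (F p ε)) : S = Finset.univ := by
  by_contra hS
  obtain ⟨i, hi⟩ : ∃ i, i ∉ S := by
    by_contra hall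
    push Not at hall
    exact hS (Finset.eq_univ_iff_forall.mpr hall)
  have hsub : S ⊆ Finset.univ.erase i := fun k hk =>
    Finset.mem_erase.mpr ⟨fun hki => hi (hki ▸ hk), Finset.mem_univ k⟩
  have h2 := lt_of_le_of_lt (le_trans h.2 (ordAlong_mono hsub (F p ε))) (ordAlong_erase_lt hε i)
  exact lt_irrefl _ h2

/-! ## the `x₂`-chart transform and the translation `x₄ ↦ x₄ − ε` -/

/-- `x₂`-chart of the point blow-up on `eA`: fixed. -/
theorem chartExponent_eA : chartExponent p Finset.univ 1 (eA p) = eA p := by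
  obtain ⟨hA, -, -, -⟩ := degIn_univ_exponents (p := p); rw [chartExponent_eq_iff, hA]; exact ⟨by simp, fun i _ => rfl⟩

/-- `x₂`-chart of the point blow-up on `eB`: `x₂x₃^{p-1} ↦ x₃^{p-1}`. -/
theorem chartExponent_eB : chartExponent p Finset.univ 1 (eB p) = eB' p := by
  obtain ⟨-, hB, -, -⟩ := degIn_univ_exponents (p := p)
  rw [chartExponent_eq_iff, hB]; refine ⟨by simp, fun i hi => ?_⟩; fin_cases i <;> simp_all

/-- `x₂`-chart of the point blow-up on `eC`: fixed. -/
theorem chartExponent_eC : chartExponent p Finset.univ 1 (eC p) = eC p := by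
  obtain ⟨-, -, hC, -⟩ := degIn_univ_exponents (p := p); rw [chartExponent_eq_iff, hC]; exact ⟨by simp, fun i _ => rfl⟩

/-- `x₂`-chart of the point blow-up on `eD`: fixed. -/
theorem chartExponent_eD : chartExponent p Finset.univ 1 (eD p) = eD p := by
  obtain ⟨-, -, -, hD⟩ := degIn_univ_exponents (p := p); rw [chartExponent_eq_iff, hD]; exact ⟨by simp, fun i _ => rfl⟩

/-- The `x₂`-chart of the point blow-up sends `F_ε` to `G_ε`. [folklore] -/
theorem chartTransform_F (ε : Kp p) : chartTransform p Finset.univ 1 (F p ε) = G p ε := by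
  rw [F, chartTransform_add, chartTransform_add, chartTransform_add, chartTransform_monomial,
    chartTransform_monomial, chartTransform_monomial, chartTransform_monomial,
    chartExponent_eA, chartExponent_eB, chartExponent_eC, chartExponent_eD, G]

/-- `x₃^{p-1}x₄` as a monomial. -/
theorem monomial_eA : (X 2 ^ (p - 1) * X 3 : MvPolynomial (Fin 4) (Kp p)) = monomial (eA p) 1 := by
  rw [X_pow_eq_monomial, X, monomial_mul, one_mul, single_eA]

/-- `ε x₂x₃^{p-1}` as a monomial. -/
theorem monomial_eB (ε : Kp p) :
    (C ε * (X 1 * X 2 ^ (p - 1)) : MvPolynomial (Fin 4) (Kp p)) = monomial (eB p) ε := by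
  rw [X_pow_eq_monomial, X, monomial_mul, one_mul, C_mul_monomial, mul_one, single_eB]

/-- `x₂x₃^{p-1}x₄` as a monomial. -/
theorem monomial_eC :
    (X 1 * X 2 ^ (p - 1) * X 3 : MvPolynomial (Fin 4) (Kp p)) = monomial (eC p) 1 := by
  rw [X_pow_eq_monomial, X, X, monomial_mul, monomial_mul, one_mul, one_mul, single_eC]

/-- `x₁^p x₂` as a monomial. -/
theorem monomial_eD : (X 0 ^ p * X 1 : MvPolynomial (Fin 4) (Kp p)) = monomial (eD p) 1 := by
  rw [X_pow_eq_monomial, X, monomial_mul, one_mul, single_eD]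

/-- `ε x₃^{p-1}` as a monomial. -/
theorem monomial_eB' (ε : Kp p) :
    (C ε * X 2 ^ (p - 1) : MvPolynomial (Fin 4) (Kp p)) = monomial (eB' p) ε := by
  rw [X_pow_eq_monomial, C_mul_monomial, mul_one, single_eB']

/-- `F_ε` written with variables. -/
theorem F_eq_X (ε : Kp p) : F p ε =
    X 2 ^ (p - 1) * X 3 + C ε * (X 1 * X 2 ^ (p - 1)) + X 1 * X 2 ^ (p - 1) * X 3 + X 0 ^ p * X 1 := by
  rw [F, ← monomial_eA, ← monomial_eB, ← monomial_eC, ← monomial_eD]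

/-- `G_ε` written with variables. -/
theorem G_eq_X (ε : Kp p) : G p ε =
    X 2 ^ (p - 1) * X 3 + C ε * X 2 ^ (p - 1) + X 1 * X 2 ^ (p - 1) * X 3 + X 0 ^ p * X 1 := by
  rw [G, ← monomial_eA, ← monomial_eB', ← monomial_eC, ← monomial_eD]

/-- Translating `G_ε` by `x₄ ↦ x₄ − ε` gives `F_{−ε}`. [folklore] -/
theorem translate_b_G (ε : Kp p) : PointBlowup.translate (b p ε) (G p ε) = F p (-ε) := by
  rw [G_eq_X, F_eq_X]
  simp only [PointBlowup.translate, map_add, map_mul, map_pow, MvPolynomial.aeval_X, MvPolynomial.aeval_C,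
    MvPolynomial.algebraMap_eq, b_zero, b_one, b_two, b_three, map_zero, add_zero, map_neg]
  ring

/-- An exponent with an entry `1` is not a `p`-th power exponent (`p` prime). -/
private theorem not_pth_of_one {d : Fin 4 →₀ ℕ} (i : Fin 4) (h : d i = 1) : ¬ IsPthPowerExponent p d :=
  fun hd => hp.out.one_lt.ne' (Nat.dvd_one.mp (h ▸ (isPthPowerExponent_iff p d).mp hd i))

/-- `F_ε` is clean (no `p`-th power monomials). [folklore] -/
theorem deletePthPowers_F (ε : Kp p) : deletePthPowers p (F p ε) = F p ε := by
  rw [F, deletePthPowers_add, deletePthPowers_add, deletePthPowers_add, deletePthPowers_monomial,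
    deletePthPowers_monomial, deletePthPowers_monomial, deletePthPowers_monomial,
    if_neg (not_pth_of_one 3 (by simp)), if_neg (not_pth_of_one 1 (by simp)),
    if_neg (not_pth_of_one 1 (by simp)), if_neg (not_pth_of_one 1 (by simp))]

/-! ## the step `s_ε ⟶ s_{−ε}` -/

/-- The transform of `s_ε` at `b_ε` in the `x₂`-chart of the point blow-up is `F_{−ε}`. -/
theorem pointTransform_s (ε : Kp p) : pointTransform p Finset.univ 1 (b p ε) (s p ε) = F p (-ε) := by
  rw [pointTransform, show (s p ε).F = F p ε from rfl, chartTransform_F, translate_b_G]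

/-- `b_ε` is an equimultiple point of `s_ε` in the `x₂`-chart of the point blow-up. -/
theorem isEquimultiplePoint_s (ε : Kp p) : IsEquimultiplePoint p Finset.univ 1 (b p ε) (s p ε) :=
  fun d _ hdeg => by rw [pointTransform_s]; exact coeff_F_of_degree_lt (-ε) hdeg

/-- Updating the zero exponent at `1` with `0` gives zero. -/
private theorem update_one_zero : (0 : Fin 4 →₀ ℕ).update 1 0 = 0 := by
  ext i; rw [Finsupp.update_apply]; split_ifs <;> rfl

/-- **The step** at `b_ε` of the `x₂`-chart of the point blow-up maps `s_ε` to `s_{−ε}`. [folklore] -/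
theorem step_s (ε : Kp p) : CentreBlowup.step p Finset.univ 1 (b p ε) (s p ε) = s p (-ε) := by
  have hF : deletePthPowers p (pointTransform p Finset.univ 1 (b p ε) (s p ε)) = F p (-ε) := by
    rw [pointTransform_s, deletePthPowers_F]
  have hr : newMult p Finset.univ 1 (b p ε) (s p ε) = 0 := by
    unfold newMult
    have hfil : ((s p ε).r.filter fun i => b p ε i = 0) = 0 := by
      rw [show (s p ε).r = 0 from rfl, Finsupp.filter_zero]
    rw [hfil, show (s p ε).F = F p ε from rfl, ordAlong_univ_F]
    simp only [ENat.toNat_coe, Nat.sub_self]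
    exact update_one_zero
  have he : newExc 1 (b p ε) (s p ε) = ({1} : Finset (Fin 4)) := by
    unfold newExc
    rw [show (s p ε).exc = {1} from rfl, Finset.filter_singleton, if_pos (b_one ε)]
    exact Finset.insert_eq_of_mem (Finset.mem_singleton_self 1)
  unfold CentreBlowup.step
  rw [hF, hr, he]; rfl

/-- `s_ε ⟶ s_{−ε}` is an edge of the point blow-up. [folklore] -/
theorem edge_s (ε : Kp p) : Edge p Finset.univ (s p ε) (s p (-ε)) :=
  ⟨1, b p ε, Finset.mem_univ _, b_one ε, isEquimultiplePoint_s ε,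
    by rw [step_s]; exact F_ne_zero _, (step_s ε).symm⟩

variable (p) in
/-- **`{s₁, s₋₁}` is a trap over `𝔽_p`.** [folklore] -/
theorem isTrap_pair : IsTrap p ({s p 1, s p (-1)} : Set (State (Kp p))) := by
  intro t ht
  simp only [Set.mem_insert_iff, Set.mem_singleton_iff] at ht
  have h1 : (1 : Kp p) ≠ 0 := one_ne_zero
  rcases ht with rfl | rfl
  · refine ⟨by rw [show (s p 1).F = F p 1 from rfl, ordAlong_univ_F], fun S hS => ⟨s p (-1), by simp, ?_⟩⟩
    have hSu : S = Finset.univ := eq_univ_of_isPermissibleCentre h1 hS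
    subst hSu
    exact edge_s 1
  · refine ⟨by rw [show (s p (-1)).F = F p (-1) from rfl, ordAlong_univ_F], fun S hS => ⟨s p 1, by simp, ?_⟩⟩
    have hSu : S = Finset.univ := eq_univ_of_isPermissibleCentre (neg_ne_zero.mpr h1) hS
    subst hSu
    have := edge_s (p := p) (-1)
    rwa [neg_neg] at this

/-- At `p = 2` the cage is TRAP-1: `s₁ = Trap1.s0` (`Theorems/PurelyInseparableDim4CoordinateTrap`). -/
theorem s_two_one : s 2 1 = Trap1.s0 := by
  have hF : F 2 1 = Trap1.F0 := by
    rw [F, show eA 2 = Trap1.eUV by ext i; fin_cases i <;> rfl, show eB 2 = Trap1.eYU by ext i; fin_cases i <;> rfl,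
      show eC 2 = Trap1.eYUV by ext i; fin_cases i <;> rfl, show eD 2 = Trap1.eXXY by ext i; fin_cases i <;> rfl]; rfl
  rw [s, hF]; rfl

end Cage

/-- **No permissible coordinate-centre rule terminates at `q = p`, for EVERY prime `p`**: the two-state
coordinate cage `{s₁, s₋₁}` over `𝔽_p` (res-dim4-idea-3's uniform family; `p = 2` is TY-7's TRAP-1).
A statement about OUR coordinate-centre frame; nothing about resolution of singularities. [folklore] -/
theorem not_terminatesSomeRule_self (p : ℕ) [Fact p.Prime] : ¬ TerminatesSomeRule p p :=
  not_terminatesSomeRule_of_trap p p (ZMod p) _ (Cage.isTrap_pair p) ⟨Cage.s p 1, by simp⟩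

/-- The same with an explicit primality hypothesis: the `@[conjecture]` `TerminatesSomeRuleQuestion` fails
at EVERY prime, not only at `p = 2` (`not_terminatesSomeRuleQuestion`). [folklore] -/
theorem not_terminatesSomeRule_of_prime (p : ℕ) (hp : p.Prime) : ¬ TerminatesSomeRule p p := by
  haveI := Fact.mk hp
  exact not_terminatesSomeRule_self p

/-- Nor an equivariant terminating rule, at any prime. [folklore] -/
theorem not_terminatesSomeEquivariantRule_of_prime (p : ℕ) (hp : p.Prime) :
    ¬ TerminatesSomeEquivariantRule p p := fun h => by
  haveI := Fact.mk hp
  obtain ⟨R, hR, -, hterm⟩ := h (ZMod p)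
  exact not_terminatesUnder_of_trap p _ (Cage.isTrap_pair p) ⟨Cage.s p 1, by simp⟩ R hR hterm

/-- **The `∀`-field form** (via res-dim4-p-14's base change): over EVERY field of characteristic `p`,
`p` any prime, every permissible coordinate-centre rule has an infinite branch at `q = p`. [folklore] -/
theorem not_terminatesUnder_of_prime (p : ℕ) [Fact p.Prime] (K : Type) [Field K] [CharP K p]
    [DecidableEq K] (R : CentreRule K) (hR : IsPermissibleRule p R) : ¬ TerminatesUnder p R :=
  BaseChange.not_terminatesUnder_of_isTrap_zmod p p (Cage.isTrap_pair p) ⟨Cage.s p 1, by simp⟩ K R hR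

/-- … hence no permissible coordinate-centre rule over any field of characteristic `p` carries a
secondary invariant at `q = p`. [folklore] -/
theorem not_secondaryInvariantUnder_of_prime (p : ℕ) [Fact p.Prime] (K : Type) [Field K] [CharP K p]
    [DecidableEq K] (R : CentreRule K) (hR : IsPermissibleRule p R) : ¬ SecondaryInvariantUnder p R :=
  fun h => not_terminatesUnder_of_prime p K R hR (BaseChange.terminatesUnder_of_secondaryInvariantUnder h)

end Summit.ResolutionOfSingularities.ResolutionOfSingularities.Theorems.PIDim4

end
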